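import Summits.KontsevichZagierPeriods.KontsevichZagierPeriods.Theses.LiouvilleUnfolding
import Summits.KontsevichZagierPeriods.KontsevichZagierPeriods.Theorems.LiouvilleUnfoldingLogKernelConjectureIffSummit
import Summits.KontsevichZagierPeriods.KontsevichZagierPeriods.Theorems.VietaFibreKernelFormItemDictionary
import Literature.NumberTheory.Transcendental.KZProductIdeal

/-!
# Item stmt-KontsevichZagierPeriods-0540 in route LiouvilleUnfolding's typing: the dictionary

`LiouvilleUnfolding.AyoubPiCancellation` (item stmt-0540, support of rank 5 of route LiouvilleUnfolding,
second antecedent of the strategist's split of the crux `LogKernelConjecture`, stmt-2837) is filed in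
INTERFACE typing: for every family `P n r : IntegralRep (n + 2)` pinned as "closed unit disc in the two
leading coordinates, `r` in the trailing `n`", `FreeAbelianGroup.lift (of ∘ P) c ∈ relations → c ∈
relations`. Its body is, character for character, the body of `AyoubSpecialisation.AyoubPiCancellation`,
so every tree theorem about the latter transports by `Iff.rfl`. This file records, for the route's own
names and without re-proving anything:

* `ayoubPiCancellation_iff_piCancellation` — the item IS the closed-term `π`-cancellation
  `KZ.PiCancellation` of `KZProduct.lean` (`[π]` is a non-zero-divisor of `FormalRep ⧸ relations`),
  equivalently injectivity of `KZ.piMulQuot` (`ayoubPiCancellation_iff_piMulQuot_injective`);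
* `ayoubPiLocalKernel_iff_piLocalKernel` — the sibling item stmt-0541 is `KZ.PiLocalKernel`;
* `eval_eq_zero_of_lift_mem_relations` — the transcendence-free content any certificate already
  carries: `lift (of ∘ P) c ∈ relations → eval c = 0` (soundness, `eval ([π]·c) = π · eval c`, `π ≠ 0`);
* `ayoubPiCancellation_of_kzKernelConjecture`, `…_of_logKernelConjecture`, `…_of_summit` — the item
  follows from Conjecture 1 in each of its tree forms, in particular from this route's own open crux;
* `logKernelConjecture_iff_ayoubPiLocalKernel_and_ayoubPiCancellation`,
  `summit_iff_ayoubPiLocalKernel_and_ayoubPiCancellation` — the split is exact in the route's typing;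
* `ayoubPiCancellation_iff_summit_of_ayoubPiLocalKernel` — GIVEN the sibling 0541, this item is the
  summit statement itself.

Status (unchanged by this file): the item is open; its motivic shadow — injectivity of formal effective
periods into formal periods with `2πi` inverted — is an open question in print (Huber–Wüstholz 2022,
App. A.3–A.4; Ayoub 2015, Rem. 1.3). Sources: M. Kontsevich, D. Zagier, *Periods* (2001), §1.2
Conjecture 1, §4.1; J. Ayoub, EMS Newsl. 91 (2014), Def. 6 / Conj. 7.
-/

noncomputable section

namespace Summit.KontsevichZagierPeriods.LiouvilleUnfolding.PiLocalisation

open Literature.NumberTheory.Transcendental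
open Summit.KontsevichZagierPeriods.KontsevichZagierPeriods.Theses

/-! ### The two pinned items are the closed-term Props of `KZProduct.lean` -/

/-- Route LiouvilleUnfolding's copy of item 0540 is route AyoubSpecialisation's, on the nose. [folklore] -/
theorem ayoubPiCancellation_iff_ayoubSpecialisation :
    LiouvilleUnfolding.AyoubPiCancellation ↔ AyoubSpecialisation.AyoubPiCancellation :=
  Iff.rfl

/-- Route LiouvilleUnfolding's copy of item 0541 is route AyoubSpecialisation's, on the nose. [folklore] -/
theorem ayoubPiLocalKernel_iff_ayoubSpecialisation :
    LiouvilleUnfolding.AyoubPiLocalKernel ↔ AyoubSpecialisation.AyoubPiLocalKernel :=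
  Iff.rfl

/-- **Item 0540 as filed is `KZ.PiCancellation`**: the pinned family exists (`[π] ⋆ r` reindexed to
`Fin (n + 2)`), is unique, and `lift (of ∘ P)` is `[π] * ·` modulo one rule-(2) move
(`BetaCancellationLine.stub_ayoubBridge`). [folklore] -/
theorem ayoubPiCancellation_iff_piCancellation :
    LiouvilleUnfolding.AyoubPiCancellation ↔ KZ.PiCancellation :=
  Summit.KontsevichZagierPeriods.KontsevichZagierPeriods.BetaCancellationLine.stub_ayoubBridge

/-- Item 0540 is injectivity of multiplication by `[π]` on `FormalRep ⧸ relations`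
(`KZ.piCancellation_iff_injective`). [folklore] -/
theorem ayoubPiCancellation_iff_piMulQuot_injective :
    LiouvilleUnfolding.AyoubPiCancellation ↔ Function.Injective KZ.piMulQuot :=
  ayoubPiCancellation_iff_piCancellation.trans KZ.piCancellation_iff_injective

/-- **Item 0541 as filed is `KZ.PiLocalKernel`**
(`KernelForm.LocaliseAtValuePrime.ayoubPiLocalKernel_iff_piLocalKernel`). [folklore] -/
theorem ayoubPiLocalKernel_iff_piLocalKernel :
    LiouvilleUnfolding.AyoubPiLocalKernel ↔ KZ.PiLocalKernel :=
  Summit.KontsevichZagierPeriods.KernelForm.LocaliseAtValuePrime.ayoubPiLocalKernel_iff_piLocalKernel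

/-! ### What a certificate already gives: the value of `c` vanishes -/

/-- **Soundness side of item 0540**: for every pinned family `P`, `lift (of ∘ P) c ∈ relations` forces
`eval c = 0` — `lift (of ∘ P) c ≡ [π] * c` modulo relations, relations evaluate to `0`, and
`eval ([π] * c) = π · eval c` with `π ≠ 0`. So the item asks exactly for the passage from `eval c = 0`
to `c ∈ relations` on the classes killed by `[π]`. [folklore] -/
theorem eval_eq_zero_of_lift_mem_relations
    (P : ∀ n : ℕ, KZ.IntegralRep n → KZ.IntegralRep (n + 2))
    (hP : ∀ (n : ℕ) (r : KZ.IntegralRep n),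
      (P n r).domain = {z : Fin (n + 2) → ℝ | z 0 ^ 2 + z 1 ^ 2 ≤ 1 ∧
          (fun i : Fin n => z i.succ.succ) ∈ r.domain} ∧
        (P n r).integrand = fun z => r.integrand (fun i : Fin n => z i.succ.succ))
    (c : KZ.FormalRep)
    (hc : FreeAbelianGroup.lift (fun s : (Σ n, KZ.IntegralRep n) => KZ.of (P s.1 s.2)) c ∈ KZ.relations) :
    KZ.eval c = 0 :=
  KZ.eval_eq_zero_of_piRep_mul_mem_relations KZ.relations_le_ker_eval_holds
    ((Summit.KontsevichZagierPeriods.KontsevichZagierPeriods.BetaCancellationLine.lift_mem_relations_iff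
      P hP c).1 hc)

/-- **Eval-sector principle** in the item's typing: on any class `c` for which Conjecture 1 is known
(`eval c = 0 → c ∈ relations`), cancellation of the pinned disc holds. [folklore] -/
theorem mem_relations_of_lift_mem_relations_of_kernelAt
    (P : ∀ n : ℕ, KZ.IntegralRep n → KZ.IntegralRep (n + 2))
    (hP : ∀ (n : ℕ) (r : KZ.IntegralRep n),
      (P n r).domain = {z : Fin (n + 2) → ℝ | z 0 ^ 2 + z 1 ^ 2 ≤ 1 ∧
          (fun i : Fin n => z i.succ.succ) ∈ r.domain} ∧
        (P n r).integrand = fun z => r.integrand (fun i : Fin n => z i.succ.succ))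
    (c : KZ.FormalRep) (hker : KZ.eval c = 0 → c ∈ KZ.relations)
    (hc : FreeAbelianGroup.lift (fun s : (Σ n, KZ.IntegralRep n) => KZ.of (P s.1 s.2)) c ∈ KZ.relations) :
    c ∈ KZ.relations :=
  hker (eval_eq_zero_of_lift_mem_relations P hP c hc)

/-! ### The item follows from Conjecture 1 in each of its tree forms -/

/-- `KZKernelConjecture → AyoubPiCancellation` (kernel form of Conjecture 1 ⇒ item 0540). [folklore] -/
theorem ayoubPiCancellation_of_kzKernelConjecture (h : KZKernelConjecture) :
    LiouvilleUnfolding.AyoubPiCancellation :=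
  ayoubPiCancellation_iff_piCancellation.2 (KZ.piCancellation_of_kernel KZ.relations_le_ker_eval_holds h)

/-- **This route's open crux implies the item**: `LogKernelConjecture → AyoubPiCancellation`
(stmt-2837 ⇒ stmt-0540), through `logKernelConjecture_iff_kzKernelConjecture`. [folklore] -/
theorem ayoubPiCancellation_of_logKernelConjecture (h : LiouvilleUnfolding.LogKernelConjecture) :
    LiouvilleUnfolding.AyoubPiCancellation :=
  ayoubPiCancellation_of_kzKernelConjecture
    (Summit.KontsevichZagierPeriods.LiouvilleUnfolding.SpectatorLocalisation.logKernelConjecture_iff_kzKernelConjecture.1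
      h)

/-- `KontsevichZagierPeriods → AyoubPiCancellation` (the summit ⇒ item 0540; so a refutation of the
item refutes the summit). [folklore] -/
theorem ayoubPiCancellation_of_summit (h : _root_.KontsevichZagierPeriods) :
    LiouvilleUnfolding.AyoubPiCancellation :=
  ayoubPiCancellation_of_logKernelConjecture
    (Summit.KontsevichZagierPeriods.LiouvilleUnfolding.SpectatorLocalisation.logKernelConjecture_iff_summit.2 h)

/-! ### The split of the crux along `[π]`, in the route's typing -/

/-- **`LogKernelConjecture ↔ AyoubPiLocalKernel ∧ AyoubPiCancellation`** (stmt-2837 ↔ stmt-0541 ∧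
stmt-0540), all three in route LiouvilleUnfolding's typing: the strategist's split is exact.
[Kontsevich–Zagier 2001, §1.2 Conj. 1, §4.1; Ayoub 2014, Def. 6 / Conj. 7] [folklore] -/
theorem logKernelConjecture_iff_ayoubPiLocalKernel_and_ayoubPiCancellation :
    LiouvilleUnfolding.LogKernelConjecture ↔
      LiouvilleUnfolding.AyoubPiLocalKernel ∧ LiouvilleUnfolding.AyoubPiCancellation :=
  Summit.KontsevichZagierPeriods.LiouvilleUnfolding.SpectatorLocalisation.logKernelConjecture_iff_kzKernelConjecture.trans
    (show KZKernelConjecture ↔ _ from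
      Summit.KontsevichZagierPeriods.KernelForm.LocaliseAtValuePrime.kernelForm_iff_ayoubPiLocalKernel_and_ayoubPiCancellation)

/-- **`KontsevichZagierPeriods ↔ AyoubPiLocalKernel ∧ AyoubPiCancellation`** in the route's typing.
[folklore] -/
theorem summit_iff_ayoubPiLocalKernel_and_ayoubPiCancellation :
    _root_.KontsevichZagierPeriods ↔
      LiouvilleUnfolding.AyoubPiLocalKernel ∧ LiouvilleUnfolding.AyoubPiCancellation :=
  Summit.KontsevichZagierPeriods.LiouvilleUnfolding.SpectatorLocalisation.logKernelConjecture_iff_summit.symm.trans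
    logKernelConjecture_iff_ayoubPiLocalKernel_and_ayoubPiCancellation

/-- **Given the sibling, the item is the summit**: under `AyoubPiLocalKernel` (stmt-0541),
`AyoubPiCancellation ↔ KontsevichZagierPeriods`. [folklore] -/
theorem ayoubPiCancellation_iff_summit_of_ayoubPiLocalKernel (h₁ : LiouvilleUnfolding.AyoubPiLocalKernel) :
    LiouvilleUnfolding.AyoubPiCancellation ↔ _root_.KontsevichZagierPeriods :=
  ⟨fun h₂ => summit_iff_ayoubPiLocalKernel_and_ayoubPiCancellation.2 ⟨h₁, h₂⟩, ayoubPiCancellation_of_summit⟩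

/-- **Given the item, the sibling is the summit**: under `AyoubPiCancellation` (stmt-0540),
`AyoubPiLocalKernel ↔ KontsevichZagierPeriods`. [folklore] -/
theorem ayoubPiLocalKernel_iff_summit_of_ayoubPiCancellation (h₂ : LiouvilleUnfolding.AyoubPiCancellation) :
    LiouvilleUnfolding.AyoubPiLocalKernel ↔ _root_.KontsevichZagierPeriods :=
  ⟨fun h₁ => summit_iff_ayoubPiLocalKernel_and_ayoubPiCancellation.2 ⟨h₁, h₂⟩,
    fun h => (summit_iff_ayoubPiLocalKernel_and_ayoubPiCancellation.1 h).1⟩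

end Summit.KontsevichZagierPeriods.LiouvilleUnfolding.PiLocalisation

end
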